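import Literature.RingTheory.KTheory.MilnorKResidueSequenceModPrime
import Literature.RingTheory.KTheory.MilnorKStiefelWhitneyAugmentationPowers
import HarnessLib

/-!
# COROLLARY 5.2: for a henselian discretely valued field `E` with residue field `Ē` of characteristic `≠ 2`,
# affirmative answers to Questions 4.3 (`sₙ : kₙ → Iⁿ/Iⁿ⁺¹` bijective) and 4.4 (`⋂ Iⁿ = 0`) for `Ē` give
# affirmative answers for `E` (Milnor, *Algebraic K-theory and quadratic forms*, Invent. Math. 9 (1970), §5)

Family `hodge`, lane `lit-hodgefound` (foundations library; seat `lit-hodgefound-p27`, generation 42, row g42-#6);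
topic `RingTheory/KTheory`.  Sequel of `MilnorKWittRingSpringerTheorem` (g42-#4: the section
`springerSection = s : W(Ē) →+* W(E)`, the retraction `rho = ρ`, the second residue `sndResidue = ∂`,
`eq_springerSection_rho_add` `w = s(ρw) + ((π) − (1))s(∂w)`, the split sequences (7ₙ) `bijOn_pow_rho_prod_sndResidue`,
`isSquare_of_res_eq_one`), of `MilnorKResidueSequenceModPrime` (g42-#5, LEMMA 2.6: the unit symbols
`MilnorK.unitSymbols`, `MilnorK.exists_mem_unitSymbols_add_cons` `x = a + l(π)b`, `MilnorK.sHom` `{ū} ↦ [{u}]` with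
`MilnorK.sHom_psi_eq_mk` `s(ψa) = [a]`), of `MilnorKWittRing` (g40: THEOREM 4.1, `WittRing.sHom F n = sₙ : kₙF → Iⁿ/Iⁿ⁺¹`
inside `Graded F = gr_I W(F)`, `grMk`, `grMk_eq_zero_iff`, `exists_sHom_eq` — every `sₙ` is onto `Iⁿ/Iⁿ⁺¹`) and of
`MilnorKStiefelWhitneyAugmentationPowers` (g40: `sHom_zero_injective`).  PROVED THEOREMS ONLY; no definition, no
named fact, no instance, no notation, 0 `sorry`, net debt 0 (D-0026).

## The source, verbatim

J. Milnor, *Algebraic K-theory and quadratic forms*, Invent. Math. 9 (1970) 318–344 (held `paper:doi-10-1007-bf01425486`;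
bib key `Milnor1970`), §4 (p0015 L29–L35): «Let F be any field of characteristic ≠ 2. **Question 4.3.** Is the
homomorphism sₙ : kₙF → Iⁿ/Iⁿ⁺¹ bijective for all values of n? **Question 4.4.** Is the intersection of the ideals Iⁿ
equal to zero?»; §5 (p0017 L26–L53), for «a field E which is complete under a discrete valuation v, with residue class
field Ē of characteristic ≠ 2» (p0016 L46–L47): «**COROLLARY 5.2.** If the questions 4.3 and 4.4 have affirmative
answers for the residue class field Ē, then they also have affirmative answers for E. *Proof.* It will be convenient to
identify WĒ with the sub-ring W₀ ⊂ WE. Note that the ideal IE then splits as a direct sum IE = IĒ ⊕ ((π) − (1))WĒ. It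
follows inductively that IⁿE = IⁿĒ ⊕ ((π) − (1))Iⁿ⁻¹Ē. Hence the sequence 5.1 gives rise to a split exact sequence
(7ₙ) 0 → IⁿĒ → IⁿE → Iⁿ⁻¹Ē → 0. Consider the diagram
  kₙĒ → kₙE → kₙ₋₁Ē
   ↓      ↓      ↓
  IⁿĒ/Iⁿ⁺¹Ē → IⁿE/Iⁿ⁺¹E → Iⁿ⁻¹Ē/IⁿĒ,
where the top sequence comes from §2.6, the vertical arrows from §4.1, and the bottom sequence is the quotient of (7ₙ)
by (7ₙ₊₁). Checking that this diagram is commutative, and then applying the Five Lemma, the conclusion follows.»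

## What is formalised (`Ē = ValResidueField v`; `sₙ` is always onto `Iⁿ/Iⁿ⁺¹` (`exists_sHom_eq`), so Question 4.3 for a
field `F` reads `∀ n, Function.Injective (WittRing.sHom F n)`, and Question 4.4 reads `(⨅ n, fundIdeal F ^ n) = ⊥`)

* §0 small complements on `gr_I W(F)` for any field: `grMk_neg`, `grMk_sub`, `ell_mul_grMk`, and `sₙ₊₁(l(x)·y) =
  ell(x)·sₙ(y)` (`sK_cons`, `sHom_kmk_cons`), `kmk_cons_eq_zero`.
* §1 the hypothesis **(H) «units of E which map to 1 in Ē are squares»** (as in `MilnorKWittRingSpringerTheorem`; it is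
  Lemma 2.6's (H₂), `exists_eq_sq_of_isSquare`; §5 derives it from `HenselianLocalRing` + `(2 : Ē) ≠ 0`), and
  **«checking that this diagram is commutative»**: the left square — for `a` in the span of the unit symbols,
  `sₙᴱ[a] = grMk (s A)` where `grMk A = sₙ^Ē[ψ a]` (`exists_sHom_kmk_psi_eq_and_sHom_kmk_eq`, and the well-defined form
  `sHom_kmk_eq_grMk_springerSection`: «identify WĒ with W₀ ⊂ WE»); `sₙ₊₁ᴱ[l(π)b] = grMk (((π) − (1))·s B)`
  (`sHom_kmk_cons_eq_grMk`); the right square — `sₙ^Ē[∂x] = grMk (∂y)` whenever `sₙ₊₁ᴱ[x] = grMk y`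
  (`sHom_kmk_boundary_eq_grMk_sndResidue`); and the key step of Lemma 2.6, `[ψa] = 0 ⇒ [a] = 0` on the span of the unit
  symbols (`kmk_eq_zero_of_kmk_psi_eq_zero`).
* §2 **COROLLARY 5.2 for Question 4.3**: **`sHom_succ_injective_of_residueField`** (`sₙ₊₁^Ē`, `sₙ^Ē` injective ⇒
  `sₙ₊₁ᴱ` injective — the Five-Lemma diagram chase, done by hand through `ρ` and `∂`), **`sHom_injective_of_residueField`**
  (all `n`, with `s₀` from `sHom_zero_injective`).
* §3 **COROLLARY 5.2 for Question 4.4**: **`iInf_pow_fundIdeal_eq_bot_of_residueField`** (`⋂ IⁿĒ = 0 ⇒ ⋂ IⁿE = 0`, by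
  `w = s(ρw) + ((π) − (1))s(∂w)` with `ρ(IⁿE) ⊂ IⁿĒ`, `∂(Iⁿ⁺¹E) ⊂ IⁿĒ`), and the corollary as printed,
  **`corollary_5_2_of_residueField`**.
* §4 complements NOT in the source (the same diagram read downwards): the converse transfers
  `sHom_injective_residueField_of_sHom_injective` (`sₙᴱ` injective ⇒ `sₙ^Ē` injective),
  `sHom_injective_residueField_of_sHom_succ_injective` (`sₙ₊₁ᴱ` injective ⇒ `sₙ^Ē` injective),
  `iInf_pow_fundIdeal_residueField_eq_bot` (`⋂ IⁿE = 0 ⇒ ⋂ IⁿĒ = 0`), hence `forall_sHom_injective_iff`,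
  `iInf_pow_fundIdeal_eq_bot_iff`.
* §5 the henselian form: **`sHom_injective_of_henselian`**, **`iInf_pow_fundIdeal_eq_bot_of_henselian`**,
  **`corollary_5_2_of_henselian`** (`[HenselianLocalRing 𝒪ᵥ]`, `(2 : Ē) ≠ 0` — complete fields are henselian).
* Not here: Corollary 5.8 (`F(t)`), Lemma 4.5 (global fields); the abstract Five Lemma is not invoked (the two rows
  are split, and the chase is two lines).

## References

* [Milnor1970] J. Milnor, *Algebraic K-theory and quadratic forms*, Invent. Math. 9 (1970) 318–344 — §4 Questions 4.3,
  4.4 (p0015 L29–L35); §5 Corollary 5.2 and its proof (p0017 L26–L53); Theorem of Springer and Cor. 5.1 (p0016 L46 –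
  p0017 L25); §2 Lemma 2.6 (p0010 L17–L27).
* [Springer1955] T.A. Springer, *Quadratic forms over fields with a discrete valuation. I*, Indag. Math. 17 (1955)
  352–362 — the structure of `W(E)` used throughout (tree: `MilnorKWittRingSpringerTheorem`).

Provenance: lane `lit-hodgefound`, seat `lit-hodgefound-p27` gen 42 (agent `literature-prover-lit-hodgefound-p27-g42-0`),
row g42-#6.
-/

set_option autoImplicit false

noncomputable section

namespace Literature.RingTheory.KTheory

open Function

namespace WittRing

/-! ### §0 Complements on `gr_I W(F)` and `sₙ` (any field) -/

section AnyField

variable (F : Type*) [Field F]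

/-- `grMk (−y) = −grMk y`. [cite: Milnor1970, §4 Theorem 4.1, the groups IⁿF/Iⁿ⁺¹F (p0014 L27–L31)] -/
theorem grMk_neg (n : ℕ) (y : WittRing F) (hy : y ∈ fundIdeal F ^ n) :
    grMk F n (-y) (neg_mem hy) = -grMk F n y hy := by
  rw [eq_neg_iff_add_eq_zero, grMk_add, ← grMk_zero F n]
  exact grMk_congr F (neg_add_cancel y) _ _

/-- `grMk (y − y') = grMk y − grMk y'`. [cite: Milnor1970, §4 Theorem 4.1, the groups IⁿF/Iⁿ⁺¹F (p0014 L27–L31)] -/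
theorem grMk_sub (n : ℕ) (y y' : WittRing F) (hy : y ∈ fundIdeal F ^ n) (hy' : y' ∈ fundIdeal F ^ n) :
    grMk F n (y - y') (sub_mem hy hy') = grMk F n y hy - grMk F n y' hy' := by
  rw [sub_eq_add_neg (grMk F n y hy), ← grMk_neg, grMk_add]
  exact grMk_congr F (sub_eq_add_neg y y') _ _

/-- `((x) − (1))·y ∈ Iⁿ⁺¹` for `y ∈ Iⁿ`. [cite: Milnor1970, §5 proof of Cor. 5.2 «((π) − (1))Iⁿ⁻¹Ē» (p0017 L32–L33)] -/
theorem gen_sub_one_mul_mem_pow_succ {n : ℕ} (x : Fˣ) {y : WittRing F} (hy : y ∈ fundIdeal F ^ n) :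
    (gen F x - 1) * y ∈ fundIdeal F ^ (n + 1) := by
  rw [pow_succ']
  exact Ideal.mul_mem_mul (gen_sub_one_mem F x) hy

/-- `ell(x)·grMk n y = grMk (n+1) (((x) − (1))·y)`. [cite: Milnor1970, §4 proof of Theorem 4.1 (p0014 L36 – p0015 L12)] -/
theorem ell_mul_grMk {n : ℕ} (x : Fˣ) (y : WittRing F) (hy : y ∈ fundIdeal F ^ n) :
    ell F x * grMk F n y hy = grMk F (n + 1) ((gen F x - 1) * y) (gen_sub_one_mul_mem_pow_succ F x hy) := by
  rw [ell_def, grMk_mul]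
  exact grMk_eq_of_eq F (Nat.add_comm 1 n) rfl _ _

/-- `s` of a left-multiplied symbol: `sK (l(x)·y) = ell(x)·sK(y)` on `KₙF`. [cite: Milnor1970, §4 Theorem 4.1 «carries each product l(a₁)⋯l(aₙ) […] to the product ((a₁) − (1))⋯((aₙ) − (1))» (p0014 L27–L35)] -/
theorem sK_cons {n : ℕ} (x : Fˣ) (y : MilnorK F n) : sK F (n + 1) (MilnorK.cons x y) = ell F x * sK F n y := by
  have h : (sK F (n + 1)).comp (MilnorK.cons x) = (AddMonoidHom.mulLeft (ell F x)).comp (sK F n) :=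
    MilnorK.hom_ext fun a => by
      rw [AddMonoidHom.comp_apply, AddMonoidHom.comp_apply, AddMonoidHom.coe_mulLeft, MilnorK.cons_symbol, sK_symbol,
        sK_symbol, List.ofFn_succ, List.prod_cons, Fin.cons_zero]
      simp only [Fin.cons_succ]
  exact DFunLike.congr_fun h y

/-- **`sₙ₊₁(l(x)·y) = ell(x)·sₙ(y)`** on `kₙF`. [cite: Milnor1970, §4 Theorem 4.1 (p0014 L27–L35)] -/
theorem sHom_kmk_cons {n : ℕ} (x : Fˣ) (y : MilnorK F n) :
    sHom F (n + 1) (MilnorK.kmk F (n + 1) (MilnorK.cons x y)) = ell F x * sHom F n (MilnorK.kmk F n y) := by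
  rw [sHom_kmk, sHom_kmk, sK_cons]

/-- If `[y] = 0` in `kₙF` then `[l(x)·y] = 0` in `kₙ₊₁F`. [cite: Milnor1970, §3 «k_nF = K_nF/2K_nF» (p0010 L27–L30)] -/
theorem kmk_cons_eq_zero {n : ℕ} (x : Fˣ) {y : MilnorK F n} (h : MilnorK.kmk F n y = 0) :
    MilnorK.kmk F (n + 1) (MilnorK.cons x y) = 0 := by
  obtain ⟨z, rfl⟩ := MilnorK.kmk_eq_zero_iff.1 h
  rw [map_zsmul]
  exact MilnorK.kmk_two_zsmul _

end AnyField

/-! ### §1 (H), and «checking that this diagram is commutative» -/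

section Ascent

variable {E : Type*} [Field E] (v : Valuation E (WithZero (Multiplicative ℤ))) {π : Eˣ} (hπ : addVal v π = 1)

/-- (H) «units ≡ 1 are squares» is Lemma 2.6's hypothesis (H₂) «units ≡ 1 have square roots». [cite: Milnor1970, §2 proof of Lemma 2.6 «If a unit of E maps to 1 in F, then it has a p-th root» (p0010 L22–L23)] -/
theorem exists_eq_sq_of_isSquare (hsq : ∀ u : Eˣ, addVal v u = 0 → res v hπ u = 1 → IsSquare u) :
    ∀ u : Eˣ, addVal v u = 0 → res v hπ u = 1 → ∃ z : Eˣ, u = z ^ 2 := fun u hu h1 => by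
  obtain ⟨r, hr⟩ := hsq u hu h1
  exact ⟨r, by rw [hr, pow_two]⟩

/-- Every element of `KₘĒ` is `ψ(a)` for some `a` in the span of the unit symbols of `KₘE` (lift the entries).
[cite: Milnor1970, §2 Lemma 2.2 «ψ […] l(π^{i₁}u₁)⋯l(π^{iₙ}uₙ) ↦ l(ū₁)⋯l(ūₙ)» (p0007 L46–L49)] -/
theorem exists_mem_closure_unitSymbols_psi_eq {m : ℕ} (x : MilnorK (ValResidueField v) m) :
    ∃ a ∈ AddSubgroup.closure (MilnorK.unitSymbols v m), MilnorK.psi v hπ m a = x := by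
  induction x using MilnorK.induction_on with
  | hsym k c =>
    choose u hu0 hures using fun j => exists_unit_res_eq v hπ (c j)
    have hu : MilnorK.symbol u ∈ MilnorK.unitSymbols v m := ⟨u, hu0, rfl⟩
    refine ⟨k • MilnorK.symbol u, AddSubgroup.zsmul_mem _ (AddSubgroup.subset_closure hu) k, ?_⟩
    rw [map_zsmul, MilnorK.psi_symbol_units]
    congr 2
    funext j
    exact hures j
  | hadd x y hx hy =>
    obtain ⟨a, ha, rfl⟩ := hx
    obtain ⟨b, hb, rfl⟩ := hy
    exact ⟨a + b, add_mem ha hb, map_add _ _ _⟩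

variable (hsq : ∀ u : Eˣ, addVal v u = 0 → res v hπ u = 1 → IsSquare u)

include hsq

/-- **The key step of LEMMA 2.6 in `kₘ = Kₘ/2Kₘ`: for `a` in the span of the unit symbols, `[ψ a] = 0` in `kₘĒ` forces
`[a] = 0` in `kₘE`** (`[a] = s(ψ a)` and `s` is additive). [cite: Milnor1970, §2 Lemma 2.6 and its proof (p0010 L17–L26)] -/
theorem kmk_eq_zero_of_kmk_psi_eq_zero {m : ℕ} {a : MilnorK E m}
    (ha : a ∈ AddSubgroup.closure (MilnorK.unitSymbols v m))
    (h : MilnorK.kmk (ValResidueField v) m (MilnorK.psi v hπ m a) = 0) : MilnorK.kmk E m a = 0 := by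
  obtain ⟨z, hz⟩ := MilnorK.kmk_eq_zero_iff.1 h
  have h2 : ((2 : ℕ) : ℤ) = 2 := by norm_num
  have hmk : ((a : MilnorK E m) : ModP (MilnorK E m) 2) = 0 := by
    rw [← MilnorK.sHom_psi_eq_mk v hπ 2 (exists_eq_sq_of_isSquare v hπ hsq) ha, ← hz, map_zsmul, ← h2]
    exact zsmul_eq_zero_modP _ 2 _
  obtain ⟨y, hy⟩ := (mem_pMultiples_iff _ 2).1 ((QuotientAddGroup.eq_zero_iff _).1 hmk)
  exact MilnorK.kmk_eq_zero_iff.2 ⟨y, by rw [← h2]; exact hy⟩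

/-- **The left square, generators: for `a` in the span of the unit symbols there is `A ∈ IᵐĒ` with `sₘ^Ē[ψ a] = grMk A`
and `sₘᴱ[a] = grMk (s A)`** («identify WĒ with the sub-ring W₀ ⊂ WE»: on unit symbols `sₘᴱ{u} = ∏((uⱼ) − (1)) =
s(∏((ūⱼ) − (1)))`). [cite: Milnor1970, §5 proof of Cor. 5.2 «It will be convenient to identify WĒ with the sub-ring W₀ ⊂ WE […] Checking that this diagram is commutative» (p0017 L28–L52)] -/
theorem exists_sHom_kmk_psi_eq_and_sHom_kmk_eq {m : ℕ} {a : MilnorK E m}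
    (ha : a ∈ AddSubgroup.closure (MilnorK.unitSymbols v m)) :
    ∃ (A : WittRing (ValResidueField v)) (hA : A ∈ fundIdeal (ValResidueField v) ^ m),
      sHom (ValResidueField v) m (MilnorK.kmk (ValResidueField v) m (MilnorK.psi v hπ m a)) =
          grMk (ValResidueField v) m A hA ∧
        sHom E m (MilnorK.kmk E m a) = grMk E m (springerSection v hπ hsq A) (springerSection_mem_pow v hπ hsq hA) := by
  induction ha using AddSubgroup.closure_induction with
  | mem z hz =>
    obtain ⟨u, hu, rfl⟩ := hz
    refine ⟨(List.ofFn fun j => gen (ValResidueField v) (res v hπ (u j)) - 1).prod, prod_gen_sub_one_mem _ _, ?_, ?_⟩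
    · rw [MilnorK.psi_symbol_units, ← MilnorK.kSymbol_def, sHom_kSymbol]
    · rw [← MilnorK.kSymbol_def, sHom_kSymbol]
      refine grMk_congr E ?_ _ _
      rw [map_list_prod, List.map_ofFn]
      congr 2
      funext j
      rw [Function.comp_apply, map_sub, map_one, springerSection_gen_res v hπ hsq (hu j)]
  | zero =>
    refine ⟨0, zero_mem _, ?_, ?_⟩
    · rw [map_zero (MilnorK.psi v hπ m), map_zero (MilnorK.kmk (ValResidueField v) m),
        map_zero (sHom (ValResidueField v) m), grMk_zero]
    · rw [map_zero (MilnorK.kmk E m), map_zero (sHom E m), eq_comm, ← grMk_zero E m]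
      exact grMk_congr E (map_zero _) _ _
  | add x y _ _ hx hy =>
    obtain ⟨A, hA, hA₁, hA₂⟩ := hx
    obtain ⟨B, hB, hB₁, hB₂⟩ := hy
    refine ⟨A + B, add_mem hA hB, ?_, ?_⟩
    · rw [map_add (MilnorK.psi v hπ m), map_add (MilnorK.kmk (ValResidueField v) m),
        map_add (sHom (ValResidueField v) m), hA₁, hB₁, grMk_add]
    · rw [map_add (MilnorK.kmk E m), map_add (sHom E m), hA₂, hB₂, grMk_add]
      exact grMk_congr E (map_add _ _ _).symm _ _
  | neg x _ hx =>
    obtain ⟨A, hA, hA₁, hA₂⟩ := hx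
    refine ⟨-A, neg_mem hA, ?_, ?_⟩
    · rw [map_neg (MilnorK.psi v hπ m), map_neg (MilnorK.kmk (ValResidueField v) m),
        map_neg (sHom (ValResidueField v) m), hA₁, grMk_neg]
    · rw [map_neg (MilnorK.kmk E m), map_neg (sHom E m), hA₂, ← grMk_neg]
      exact grMk_congr E (map_neg _ _).symm _ _

/-- **The left square is commutative: `sₘᴱ[a] = grMk (s A)` whenever `sₘ^Ē[ψ a] = grMk A`**, for `a` in the span of the
unit symbols (well defined: `s(Iᵐ⁺¹Ē) ⊂ Iᵐ⁺¹E`). [cite: Milnor1970, §5 proof of Cor. 5.2 «Checking that this diagram is commutative» (p0017 L40–L52)] -/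
theorem sHom_kmk_eq_grMk_springerSection {m : ℕ} {a : MilnorK E m}
    (ha : a ∈ AddSubgroup.closure (MilnorK.unitSymbols v m)) {A : WittRing (ValResidueField v)}
    {hA : A ∈ fundIdeal (ValResidueField v) ^ m}
    (h : sHom (ValResidueField v) m (MilnorK.kmk (ValResidueField v) m (MilnorK.psi v hπ m a)) =
      grMk (ValResidueField v) m A hA) :
    sHom E m (MilnorK.kmk E m a) = grMk E m (springerSection v hπ hsq A) (springerSection_mem_pow v hπ hsq hA) := by
  obtain ⟨A₀, hA₀, h₁, h₂⟩ := exists_sHom_kmk_psi_eq_and_sHom_kmk_eq v hπ hsq ha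
  rw [h₂, grMk_eq_grMk_iff, ← map_sub]
  exact springerSection_mem_pow v hπ hsq ((grMk_eq_grMk_iff _ _ _ _ _).1 (h₁.symm.trans h))

/-- **`sₙ₊₁ᴱ[l(π)·b] = grMk (((π) − (1))·s B)`** when `sₙᴱ[b] = grMk (s B)` (the summand `((π) − (1))Iⁿ⁻¹Ē`).
[cite: Milnor1970, §5 proof of Cor. 5.2 «IⁿE = IⁿĒ ⊕ ((π) − (1))Iⁿ⁻¹Ē» (p0017 L32–L33)] -/
theorem sHom_kmk_cons_eq_grMk {n : ℕ} {b : MilnorK E n} {B : WittRing (ValResidueField v)}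
    (hB : B ∈ fundIdeal (ValResidueField v) ^ n)
    (h : sHom E n (MilnorK.kmk E n b) = grMk E n (springerSection v hπ hsq B) (springerSection_mem_pow v hπ hsq hB)) :
    sHom E (n + 1) (MilnorK.kmk E (n + 1) (MilnorK.cons π b)) =
      grMk E (n + 1) ((gen E π - 1) * springerSection v hπ hsq B)
        (gen_sub_one_mul_mem_pow_succ E π (springerSection_mem_pow v hπ hsq hB)) := by
  rw [sHom_kmk_cons, h, ell_mul_grMk]

/-- `ρ(s A + ((π) − (1))·s B) = A`. [cite: Milnor1970, §5 Cor. 5.1 «ρ(πu) = (ū)» (p0017 L16–L21); proof of Cor. 5.2 (p0017 L28–L33)] -/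
theorem rho_springerSection_add (A B : WittRing (ValResidueField v)) :
    rho v hπ (springerSection v hπ hsq A + (gen E π - 1) * springerSection v hπ hsq B) = A := by
  rw [map_add, map_mul, map_sub, map_one, rho_gen_pi, sub_self, zero_mul, add_zero, rho_springerSection]

/-- `∂(s A + ((π) − (1))·s B) = B`. [cite: Milnor1970, §5 Cor. 5.1 «∂(πu) = (ū)» (p0017 L16–L21); proof of Cor. 5.2 (p0017 L28–L33)] -/
theorem sndResidue_springerSection_add (A B : WittRing (ValResidueField v)) :
    sndResidue v hπ (springerSection v hπ hsq A + (gen E π - 1) * springerSection v hπ hsq B) = B := by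
  rw [map_add, sndResidue_springerSection, zero_add, sub_mul, one_mul, map_sub, sndResidue_gen_pi_mul_springerSection,
    sndResidue_springerSection, sub_zero]

/-- **The right square is commutative: `sₙ^Ē[∂x] = grMk (∂y)` whenever `sₙ₊₁ᴱ[x] = grMk y`** (`y ∈ Iⁿ⁺¹E`; the bottom map
`IⁿE/Iⁿ⁺¹E → Iⁿ⁻¹Ē/IⁿĒ` of the quotient of (7ₙ) by (7ₙ₊₁) is induced by `∂`, `∂(IᵐE) ⊂ Iᵐ⁻¹Ē`).
[cite: Milnor1970, §5 proof of Cor. 5.2 «the bottom sequence is the quotient of (7ₙ) by (7ₙ₊₁). Checking that this diagram is commutative» (p0017 L40–L52)] -/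
theorem sHom_kmk_boundary_eq_grMk_sndResidue {n : ℕ} (x : MilnorK E (n + 1)) {y : WittRing E}
    {hy : y ∈ fundIdeal E ^ (n + 1)} (h : sHom E (n + 1) (MilnorK.kmk E (n + 1) x) = grMk E (n + 1) y hy) :
    sHom (ValResidueField v) n (MilnorK.kmk (ValResidueField v) n (MilnorK.boundary v hπ n x)) =
      grMk (ValResidueField v) n (sndResidue v hπ y) (sndResidue_mem_pow v hπ hy) := by
  obtain ⟨a, ha, b, hb, rfl⟩ := MilnorK.exists_mem_unitSymbols_add_cons v hπ x
  obtain ⟨A, hA, -, hA₂⟩ := exists_sHom_kmk_psi_eq_and_sHom_kmk_eq v hπ hsq ha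
  obtain ⟨B, hB, hB₁, hB₂⟩ := exists_sHom_kmk_psi_eq_and_sHom_kmk_eq v hπ hsq hb
  have hB₃ := sHom_kmk_cons_eq_grMk v hπ hsq hB hB₂
  rw [map_add (MilnorK.kmk E (n + 1)), map_add (sHom E (n + 1)), hA₂, hB₃, grMk_add, grMk_eq_grMk_iff] at h
  -- `∂x = ψ b`, and `∂y ≡ ∂(s A + ((π) − (1))s B) = B` modulo `IⁿĒ`
  rw [map_add (MilnorK.boundary v hπ n), MilnorK.boundary_eq_zero_of_mem_closure_unitSymbols v hπ ha, zero_add,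
    MilnorK.boundary_cons_eq_psi v hπ hb, hB₁, grMk_eq_grMk_iff,
    ← sndResidue_springerSection_add v hπ hsq A B, ← map_sub]
  exact sndResidue_mem_pow v hπ h

/-! ### §2 COROLLARY 5.2 for Question 4.3 -/

/-- **COROLLARY 5.2 (Question 4.3), one degree: if `sₙ₊₁^Ē` and `sₙ^Ē` are injective then `sₙ₊₁ᴱ` is injective**
(write `x = a + l(π)b`; `sₙ₊₁ᴱ[x] = grMk (s A + ((π) − (1))s B)`; if this vanishes then `A = ρ(…) ∈ Iⁿ⁺²Ē` and
`B = ∂(…) ∈ Iⁿ⁺¹Ē`, so `[ψa] = 0 = [ψb]`, so `[a] = 0 = [b]`). [cite: Milnor1970, §5 Corollary 5.2 and its proof (p0017 L26–L53)] -/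
theorem sHom_succ_injective_of_residueField {n : ℕ}
    (h₁ : Injective (sHom (ValResidueField v) (n + 1))) (h₀ : Injective (sHom (ValResidueField v) n)) :
    Injective (sHom E (n + 1)) := by
  refine (injective_iff_map_eq_zero _).2 fun ξ hξ => ?_
  obtain ⟨x, rfl⟩ := MilnorK.kmk_surjective ξ
  obtain ⟨a, ha, b, hb, rfl⟩ := MilnorK.exists_mem_unitSymbols_add_cons v hπ x
  obtain ⟨A, hA, hA₁, hA₂⟩ := exists_sHom_kmk_psi_eq_and_sHom_kmk_eq v hπ hsq ha
  obtain ⟨B, hB, hB₁, hB₂⟩ := exists_sHom_kmk_psi_eq_and_sHom_kmk_eq v hπ hsq hb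
  have hB₃ := sHom_kmk_cons_eq_grMk v hπ hsq hB hB₂
  -- `Y = s A + ((π) − (1))·s B` represents `sₙ₊₁ᴱ[x] = 0`, so `Y ∈ Iⁿ⁺²E`
  have hY : springerSection v hπ hsq A + (gen E π - 1) * springerSection v hπ hsq B ∈ fundIdeal E ^ (n + 1 + 1) := by
    rw [← grMk_eq_zero_iff E _ (add_mem (springerSection_mem_pow v hπ hsq hA)
      (gen_sub_one_mul_mem_pow_succ E π (springerSection_mem_pow v hπ hsq hB))),
      ← grMk_add E (n + 1) _ _ (springerSection_mem_pow v hπ hsq hA)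
        (gen_sub_one_mul_mem_pow_succ E π (springerSection_mem_pow v hπ hsq hB)), ← hA₂, ← hB₃,
      ← map_add (sHom E (n + 1)), ← map_add (MilnorK.kmk E (n + 1))]
    exact hξ
  have hA' : A ∈ fundIdeal (ValResidueField v) ^ (n + 1 + 1) := by
    have h := rho_mem_pow v hπ hY
    rwa [rho_springerSection_add] at h
  have hB' : B ∈ fundIdeal (ValResidueField v) ^ (n + 1) := by
    have h := sndResidue_mem_pow v hπ hY
    rwa [sndResidue_springerSection_add] at h
  have ha0 : MilnorK.kmk E (n + 1) a = 0 :=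
    kmk_eq_zero_of_kmk_psi_eq_zero v hπ hsq ha (h₁ (by rw [hA₁, map_zero, grMk_eq_zero_iff]; exact hA'))
  have hb0 : MilnorK.kmk E n b = 0 :=
    kmk_eq_zero_of_kmk_psi_eq_zero v hπ hsq hb (h₀ (by rw [hB₁, map_zero, grMk_eq_zero_iff]; exact hB'))
  rw [map_add (MilnorK.kmk E (n + 1)), ha0, kmk_cons_eq_zero E π hb0, add_zero]

/-- **COROLLARY 5.2 (Question 4.3): if every `sₙ^Ē : kₙĒ → IⁿĒ/Iⁿ⁺¹Ē` is injective (hence bijective), then so is every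
`sₙᴱ`.** [cite: Milnor1970, §5 Corollary 5.2 (p0017 L26–L27); §4 Question 4.3 (p0015 L31–L32)] -/
theorem sHom_injective_of_residueField (h : ∀ n, Injective (sHom (ValResidueField v) n)) (n : ℕ) :
    Injective (sHom E n) := by
  cases n with
  | zero => exact sHom_zero_injective E
  | succ n => exact sHom_succ_injective_of_residueField v hπ hsq (h (n + 1)) (h n)

/-! ### §3 COROLLARY 5.2 for Question 4.4 -/

/-- **COROLLARY 5.2 (Question 4.4): if `⋂ₙ IⁿĒ = 0` then `⋂ₙ IⁿE = 0`** (`w = s(ρw) + ((π) − (1))·s(∂w)` with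
`ρ(IⁿE) ⊂ IⁿĒ` and `∂(Iⁿ⁺¹E) ⊂ IⁿĒ`). [cite: Milnor1970, §5 Corollary 5.2 and its proof (p0017 L26–L33); §4 Question 4.4 (p0015 L34–L35)] -/
theorem iInf_pow_fundIdeal_eq_bot_of_residueField (h : (⨅ n : ℕ, fundIdeal (ValResidueField v) ^ n) = ⊥) :
    (⨅ n : ℕ, fundIdeal E ^ n) = ⊥ := by
  refine eq_bot_iff.2 fun w hw => ?_
  have hw' : ∀ n : ℕ, w ∈ fundIdeal E ^ n := fun n => (Ideal.mem_iInf.1 hw) n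
  have hρ : rho v hπ w = 0 := by
    have h' : rho v hπ w ∈ ⨅ n : ℕ, fundIdeal (ValResidueField v) ^ n :=
      Ideal.mem_iInf.2 fun n => rho_mem_pow v hπ (hw' n)
    rwa [h, Ideal.mem_bot] at h'
  have hd : sndResidue v hπ w = 0 := by
    have h' : sndResidue v hπ w ∈ ⨅ n : ℕ, fundIdeal (ValResidueField v) ^ n :=
      Ideal.mem_iInf.2 fun n => sndResidue_mem_pow v hπ (hw' (n + 1))
    rwa [h, Ideal.mem_bot] at h'
  rw [Ideal.mem_bot, eq_springerSection_rho_add v hπ hsq w, hρ, hd, map_zero, mul_zero, add_zero]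

/-- **COROLLARY 5.2, as printed: «If the questions 4.3 and 4.4 have affirmative answers for the residue class field Ē,
then they also have affirmative answers for E»** (for `E` with (H): units `≡ 1` are squares).
[cite: Milnor1970, §5 Corollary 5.2 (p0017 L26–L27)] -/
theorem corollary_5_2_of_residueField (h43 : ∀ n, Injective (sHom (ValResidueField v) n))
    (h44 : (⨅ n : ℕ, fundIdeal (ValResidueField v) ^ n) = ⊥) :
    (∀ n, Injective (sHom E n)) ∧ (⨅ n : ℕ, fundIdeal E ^ n) = ⊥ :=
  ⟨sHom_injective_of_residueField v hπ hsq h43, iInf_pow_fundIdeal_eq_bot_of_residueField v hπ hsq h44⟩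

/-! ### §4 Complements (not in the source): the transfers downwards -/

/-- `sₙᴱ` injective ⇒ `sₙ^Ē` injective (the composite `kₙĒ → kₙE → IⁿE/Iⁿ⁺¹E` is `grMk ∘ s ∘ sₙ^Ē`). Not stated in the
source; read off the same diagram. [cite: Milnor1970, §5 proof of Cor. 5.2, the diagram (p0017 L40–L53)] -/
theorem sHom_injective_residueField_of_sHom_injective {n : ℕ} (h : Injective (sHom E n)) :
    Injective (sHom (ValResidueField v) n) := by
  refine (injective_iff_map_eq_zero _).2 fun ξ hξ => ?_
  obtain ⟨x, rfl⟩ := MilnorK.kmk_surjective ξ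
  obtain ⟨a, ha, rfl⟩ := exists_mem_closure_unitSymbols_psi_eq v hπ x
  obtain ⟨A, hA, hA₁, hA₂⟩ := exists_sHom_kmk_psi_eq_and_sHom_kmk_eq v hπ hsq ha
  have hA' : A ∈ fundIdeal (ValResidueField v) ^ (n + 1) := by rw [← grMk_eq_zero_iff _ A hA, ← hA₁]; exact hξ
  have ha0 : MilnorK.kmk E n a = 0 :=
    h (by rw [hA₂, map_zero, grMk_eq_zero_iff]; exact springerSection_mem_pow v hπ hsq hA')
  obtain ⟨z, rfl⟩ := MilnorK.kmk_eq_zero_iff.1 ha0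
  rw [map_zsmul, MilnorK.kmk_two_zsmul]

/-- `sₙ₊₁ᴱ` injective ⇒ `sₙ^Ē` injective (through `b ↦ l(π)·b` and `∂`). Not stated in the source; read off the same
diagram. [cite: Milnor1970, §5 proof of Cor. 5.2, the diagram (p0017 L40–L53)] -/
theorem sHom_injective_residueField_of_sHom_succ_injective {n : ℕ} (h : Injective (sHom E (n + 1))) :
    Injective (sHom (ValResidueField v) n) := by
  refine (injective_iff_map_eq_zero _).2 fun ξ hξ => ?_
  obtain ⟨x, rfl⟩ := MilnorK.kmk_surjective ξ
  obtain ⟨b, hb, rfl⟩ := exists_mem_closure_unitSymbols_psi_eq v hπ x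
  obtain ⟨B, hB, hB₁, hB₂⟩ := exists_sHom_kmk_psi_eq_and_sHom_kmk_eq v hπ hsq hb
  have hB₃ := sHom_kmk_cons_eq_grMk v hπ hsq hB hB₂
  have hB' : B ∈ fundIdeal (ValResidueField v) ^ (n + 1) := by rw [← grMk_eq_zero_iff _ B hB, ← hB₁]; exact hξ
  have hb0 : MilnorK.kmk E (n + 1) (MilnorK.cons π b) = 0 :=
    h (by
      rw [hB₃, map_zero, grMk_eq_zero_iff]
      exact gen_sub_one_mul_mem_pow_succ E π (springerSection_mem_pow v hπ hsq hB'))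
  obtain ⟨z, hz⟩ := MilnorK.kmk_eq_zero_iff.1 hb0
  rw [← MilnorK.boundary_cons_eq_psi v hπ hb, ← hz, map_zsmul, MilnorK.kmk_two_zsmul]

/-- `⋂ₙ IⁿE = 0 ⇒ ⋂ₙ IⁿĒ = 0` (`s(IⁿĒ) ⊂ IⁿE` and `ρ ∘ s = id`). Not stated in the source. [cite: Milnor1970, §5 proof of Cor. 5.2 «identify WĒ with the sub-ring W₀ ⊂ WE» (p0017 L28–L29)] -/
theorem iInf_pow_fundIdeal_residueField_eq_bot (h : (⨅ n : ℕ, fundIdeal E ^ n) = ⊥) :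
    (⨅ n : ℕ, fundIdeal (ValResidueField v) ^ n) = ⊥ := by
  refine eq_bot_iff.2 fun A hA => ?_
  have h' : springerSection v hπ hsq A ∈ ⨅ n : ℕ, fundIdeal E ^ n :=
    Ideal.mem_iInf.2 fun n => springerSection_mem_pow v hπ hsq ((Ideal.mem_iInf.1 hA) n)
  rw [h, Ideal.mem_bot] at h'
  rw [Ideal.mem_bot, ← rho_springerSection v hπ hsq A, h', map_zero]

/-- Question 4.3 holds for `E` iff it holds for `Ē` (under (H)). The «if» is Corollary 5.2; the «only if» is not in the
source. [cite: Milnor1970, §5 Corollary 5.2 (p0017 L26–L27)] -/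
theorem forall_sHom_injective_iff :
    (∀ n, Injective (sHom E n)) ↔ ∀ n, Injective (sHom (ValResidueField v) n) :=
  ⟨fun h n => sHom_injective_residueField_of_sHom_injective v hπ hsq (h n), sHom_injective_of_residueField v hπ hsq⟩

/-- Question 4.4 holds for `E` iff it holds for `Ē` (under (H)). The «if» is Corollary 5.2; the «only if» is not in the
source. [cite: Milnor1970, §5 Corollary 5.2 (p0017 L26–L27)] -/
theorem iInf_pow_fundIdeal_eq_bot_iff :
    (⨅ n : ℕ, fundIdeal E ^ n) = ⊥ ↔ (⨅ n : ℕ, fundIdeal (ValResidueField v) ^ n) = ⊥ :=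
  ⟨iInf_pow_fundIdeal_residueField_eq_bot v hπ hsq, iInf_pow_fundIdeal_eq_bot_of_residueField v hπ hsq⟩

end Ascent

/-! ### §5 The henselian (in particular the complete) case -/

section Hensel

variable {E : Type*} [Field E] (v : Valuation E (WithZero (Multiplicative ℤ))) {π : Eˣ} (hπ : addVal v π = 1)

include hπ

/-- **COROLLARY 5.2 (Question 4.3) for a henselian valuation ring with `char Ē ≠ 2`** («E complete under a discrete
valuation v, with residue class field Ē of characteristic ≠ 2»; complete discrete valuation rings are henselian).
[cite: Milnor1970, §5 Corollary 5.2 (p0017 L26–L27); the standing hypothesis (p0016 L46–L47)] -/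
theorem sHom_injective_of_henselian [HenselianLocalRing v.valuationSubring] (h2 : (2 : ValResidueField v) ≠ 0)
    (h : ∀ n, Injective (sHom (ValResidueField v) n)) (n : ℕ) : Injective (sHom E n) :=
  sHom_injective_of_residueField v hπ (fun _ hu h1 => isSquare_of_res_eq_one v hπ h2 hu h1) h n

/-- **COROLLARY 5.2 (Question 4.4) for a henselian valuation ring with `char Ē ≠ 2`.** [cite: Milnor1970, §5 Corollary 5.2 (p0017 L26–L27); the standing hypothesis (p0016 L46–L47)] -/
theorem iInf_pow_fundIdeal_eq_bot_of_henselian [HenselianLocalRing v.valuationSubring]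
    (h2 : (2 : ValResidueField v) ≠ 0) (h : (⨅ n : ℕ, fundIdeal (ValResidueField v) ^ n) = ⊥) :
    (⨅ n : ℕ, fundIdeal E ^ n) = ⊥ :=
  iInf_pow_fundIdeal_eq_bot_of_residueField v hπ (fun _ hu h1 => isSquare_of_res_eq_one v hπ h2 hu h1) h

/-- **COROLLARY 5.2 as printed, henselian form.** [cite: Milnor1970, §5 Corollary 5.2 «If the questions 4.3 and 4.4 have affirmative answers for the residue class field Ē, then they also have affirmative answers for E» (p0017 L26–L27)] -/
theorem corollary_5_2_of_henselian [HenselianLocalRing v.valuationSubring] (h2 : (2 : ValResidueField v) ≠ 0)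
    (h43 : ∀ n, Injective (sHom (ValResidueField v) n)) (h44 : (⨅ n : ℕ, fundIdeal (ValResidueField v) ^ n) = ⊥) :
    (∀ n, Injective (sHom E n)) ∧ (⨅ n : ℕ, fundIdeal E ^ n) = ⊥ :=
  corollary_5_2_of_residueField v hπ (fun _ hu h1 => isSquare_of_res_eq_one v hπ h2 hu h1) h43 h44

end Hensel

end WittRing

end Literature.RingTheory.KTheory
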